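import Literature.Computability.QuantumComplexity.LightConeMachineGate
import HarnessLib

/-!
# The light-cone simulator as an `FP` machine, IV: coordinate growth, the gate pass, the read-out and the verdict

Fourth machine file of the discharge of `Literature.Barriers.QuantumAdvantage.markovShi2008_cor15_anyOrder`
(Markov–Shi 2008, Cor. 1.5, decision form).

* **Coordinate growth.** `AmpLt t a`: all four coordinates of `a` are `< 2^t` in absolute value.
  The initial state has `AmpLt 1`, one gate raises `t` by at most one (`H` adds two coordinates,
  `S`/`T` permute and negate, `CNOT` copies), so after `k` gates every stored code has at most
  `14 (k + 1) + 20` symbols and the state code at most `2^{|S|} (4N + 28k + 74)`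
  (`length_stEnc_runGates_le`) — the polynomial sizes the yardstick must dominate;
* **`gatePassF`** — on `⟨⟨⟨Y, w₀⟩, st₀⟩, ccEnc cc⟩`, the fold over the kept gate codes of the
  clipped step "parse the code into `gateParams`, apply `applyMapF`"; it is in `FP`, and computes
  `stEnc (runGates cc (initState S base))` when `14 |cc| + 48 ≤ |Y|` and
  `2^{|S|} (4N + 28|cc| + 74) ≤ |input| + 1` (`gatePassF_spec`);
* **`sumPassF`** — on `⟨Y, stEnc st⟩`, the fold over the entries accumulating
  `⟨dpEnc A, dpEnc B⟩ = (Σ_{y₀=1} A(a_y), Σ_{y₀=1} B(a_y))` (`LightCone.sums`); the step is clipped,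
  the sums being short when the coordinates are (`natAbs_sums_le`, `sumPassF_spec`);
* **`verdictF`** — on `⟨⟨A, B⟩, 1ʰ⟩`, the bit `[0 < 10A + 14B − 5·2ʰ]` (the integer test
  `LightCone.decisionW`), by additions of canonical integer codes (`verdictF_apply`).

## References

* S. Arora, B. Barak, *Computational Complexity: A Modern Approach*, CUP 2009, §1.3, §1.4.1.
* M. A. Nielsen, I. L. Chuang, *Quantum Computation and Quantum Information*, CUP 2010, Box 4.1
  (the `2ⁿ` amplitudes; here `2^{|S|}` with `|S| = O(log n)`).
* L. M. Adleman, J. DeMarrais, M.-D. A. Huang, *Quantum computability*, SIAM J. Comput. 26 (1997),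
  §6 Lemma 6.10 (integer tests for `ℤ[√2]/2^h`-valued probabilities).
-/

noncomputable section

namespace Literature.Computability.QuantumComplexity

open _root_.Computability Complexity Complexity.Brick Complexity.Plumb Cryptography

namespace LightCone

attribute [-simp] Brick.nthF_zero Brick.sndPow_zero

variable {N : ℕ}

/-! ### Growth of the coordinates along the simulation -/

/-- All coordinates of `a` are `< 2^t` in absolute value. [folklore] -/
def AmpLt (t : ℕ) (a : Amp) : Prop :=
  a.c0.natAbs < 2 ^ t ∧ a.c1.natAbs < 2 ^ t ∧ a.c2.natAbs < 2 ^ t ∧ a.c3.natAbs < 2 ^ t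

/-- `0` is small. [folklore] -/
theorem ampLt_zero (t : ℕ) : AmpLt t 0 := by
  simp only [AmpLt, Amp.zero_def, Int.natAbs_zero]; exact ⟨Nat.two_pow_pos t, Nat.two_pow_pos t, Nat.two_pow_pos t, Nat.two_pow_pos t⟩

/-- `1` is small from `t = 1` on. [folklore] -/
theorem ampLt_one {t : ℕ} (ht : 1 ≤ t) : AmpLt t 1 := by
  have h : (1 : ℕ) < 2 ^ t := Nat.one_lt_two_pow (by omega)
  simp only [AmpLt, Amp.one_def, Int.natAbs_zero, Int.natAbs_one]
  exact ⟨h, Nat.two_pow_pos t, Nat.two_pow_pos t, Nat.two_pow_pos t⟩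

/-- Monotonicity in the exponent. [folklore] -/
theorem AmpLt.mono {t t' : ℕ} {a : Amp} (h : AmpLt t a) (htt' : t ≤ t') : AmpLt t' a := by
  have hp : 2 ^ t ≤ 2 ^ t' := Nat.pow_le_pow_right (by norm_num) htt'
  obtain ⟨h0, h1, h2, h3⟩ := h
  exact ⟨h0.trans_le hp, h1.trans_le hp, h2.trans_le hp, h3.trans_le hp⟩

/-- Negation preserves smallness. [folklore] -/
theorem AmpLt.neg {t : ℕ} {a : Amp} (h : AmpLt t a) : AmpLt t (-a) := by
  obtain ⟨h0, h1, h2, h3⟩ := h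
  simp only [AmpLt, Amp.neg_def, Int.natAbs_neg]
  exact ⟨h0, h1, h2, h3⟩

/-- Multiplication by `ω` preserves smallness. [folklore] -/
theorem AmpLt.mulOmega {t : ℕ} {a : Amp} (h : AmpLt t a) : AmpLt t a.mulOmega := by
  obtain ⟨h0, h1, h2, h3⟩ := h
  simp only [AmpLt, Amp.mulOmega, Int.natAbs_neg]
  exact ⟨h3, h0, h1, h2⟩

/-- A sum of small quadruples is small at the next exponent. [folklore] -/
theorem AmpLt.add {t : ℕ} {a b : Amp} (ha : AmpLt t a) (hb : AmpLt t b) : AmpLt (t + 1) (a + b) := by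
  obtain ⟨a0, a1, a2, a3⟩ := ha
  obtain ⟨b0, b1, b2, b3⟩ := hb
  simp only [AmpLt, Amp.add_def, pow_succ]
  refine ⟨?_, ?_, ?_, ?_⟩ <;>
    refine lt_of_le_of_lt (Int.natAbs_add_le _ _) ?_ <;> omega

/-- Lookups in a state with small codes are small. [folklore] -/
theorem ampLt_lookup {t : ℕ} {st : List (QReg N × Amp)} (hst : ∀ p ∈ st, AmpLt t p.2) (y : QReg N) :
    AmpLt t (lookup st y) := by
  induction st with
  | nil => exact ampLt_zero t
  | cons p st ih =>
    rw [lookup_cons]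
    split_ifs
    · exact hst p List.mem_cons_self
    · exact ih fun q hq => hst q (List.mem_cons_of_mem p hq)

/-- **One gate raises the exponent by at most one.** [folklore] -/
theorem ampLt_newAmp {t : ℕ} {st : List (QReg N × Amp)} (hst : ∀ p ∈ st, AmpLt t p.2)
    (g : QGate cliffordT N) {p : QReg N × Amp} (hp : p ∈ st) : AmpLt (t + 1) (newAmp st g p) := by
  have hL := ampLt_lookup hst
  have ha : AmpLt t p.2 := hst p hp
  cases g with
  | oracle k e => exact ha.mono (Nat.le_succ t)
  | gate op e =>
    cases op with
    | H =>
      simp only [newAmp]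
      split_ifs
      · exact (hL _).add (hL _).neg
      · exact (hL _).add (hL _)
    | S =>
      simp only [newAmp]
      split_ifs
      · exact ha.mulOmega.mulOmega.mono (Nat.le_succ t)
      · exact ha.mono (Nat.le_succ t)
    | T =>
      simp only [newAmp]
      split_ifs
      · exact ha.mulOmega.mono (Nat.le_succ t)
      · exact ha.mono (Nat.le_succ t)
    | CNOT =>
      simp only [newAmp]
      exact (hL _).mono (Nat.le_succ t)

/-- The codes after a gate. [folklore] -/
theorem ampLt_applyGate {t : ℕ} {st : List (QReg N × Amp)} (hst : ∀ p ∈ st, AmpLt t p.2)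
    (g : QGate cliffordT N) : ∀ q ∈ applyGate g st, AmpLt (t + 1) q.2 := by
  intro q hq
  obtain ⟨p, hp, rfl⟩ := (mem_applyGate_iff g st q).1 hq
  exact ampLt_newAmp hst g hp

/-- The codes after a gate list. [folklore] -/
theorem ampLt_runGates : ∀ (gs : List (QGate cliffordT N)) {t : ℕ} {st : List (QReg N × Amp)},
    (∀ p ∈ st, AmpLt t p.2) → ∀ q ∈ runGates gs st, AmpLt (t + gs.length) q.2
  | [], t, st, hst => by simpa [runGates] using hst
  | g :: gs, t, st, hst => by
    intro q hq
    rw [runGates_cons] at hq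
    have h := ampLt_runGates gs (ampLt_applyGate hst g) q hq
    simpa [Nat.add_assoc, Nat.add_comm 1] using h

/-- The codes of the initial state have exponent `1`. [folklore] -/
theorem ampLt_initState (S : List (Fin N)) (base : QReg N) : ∀ p ∈ initState S base, AmpLt 1 p.2 := by
  intro p hp
  rcases snd_mem_initState S base p hp with h | h
  · rw [h]; exact ampLt_zero 1
  · rw [h]; exact ampLt_one le_rfl

/-- A small quadruple has a short code. [folklore] -/
theorem AmpLt.length_ampEnc_le {t : ℕ} {a : Amp} (h : AmpLt t a) : (ampEnc a).length ≤ 14 * t + 20 :=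
  length_ampEnc_le_of_lt h.1 h.2.1 h.2.2.1 h.2.2.2

/-- **Size of the state code after `k` gates** from the initial state:
`|stEnc st_k| ≤ 2^{|S|} (4N + 28k + 74)`. [folklore] -/
theorem length_stEnc_runGates_le (S : List (Fin N)) (base : QReg N) (gs : List (QGate cliffordT N)) :
    (stEnc (runGates gs (initState S base))).length ≤ 2 ^ S.length * (4 * N + 28 * gs.length + 74) := by
  have hamp := ampLt_runGates gs (ampLt_initState S base)
  have h := length_stEnc_le (st := runGates gs (initState S base)) (K := 2 * N + 14 * gs.length + 36) fun p hp => by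
    rw [length_itemEnc]
    have := (hamp p hp).length_ampEnc_le
    omega
  rw [length_runGates, length_initState] at h
  refine h.trans (le_of_eq ?_)
  ring

/-! ### The gate pass -/

/-- The environment `E = ⟨⟨Y, w₀⟩, st₀⟩` of the pass (field `0` of the step record, first part).
[folklore] -/
def gpEF : List Bool → List Bool := fstF ∘ nthF 0
/-- The yardstick `Y`. [folklore] -/
def gpYF : List Bool → List Bool := fstF ∘ fstF ∘ gpEF
/-- The base label `w₀` (ruler of the binary-to-unary conversions). [folklore] -/
def gpW0F : List Bool → List Bool := sndF ∘ fstF ∘ gpEF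
/-- The first wire of the code, unary. [folklore] -/
def gpUiF : List Bool → List Bool := binToUnaryFn ∘ pr gpW0F iF
/-- The second wire of the code, unary. [folklore] -/
def gpUjF : List Bool → List Bool := binToUnaryFn ∘ pr gpW0F jF
/-- The parameter record `⟨⟨op, ⟨1ⁱ, 1ʲ⟩⟩, Y⟩` of the code. [folklore] -/
def gpParamsF : List Bool → List Bool := pr (pr opF (pr gpUiF gpUjF)) gpYF

/-- **One step of the gate pass** (clipped): parse the code, apply the gate to the accumulated state.
[folklore] -/
def gateStepF : List Bool → List Bool := clipF 1 (applyMapF ∘ pr gpParamsF (sndPow 1))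

/-- **The gate pass**: on `⟨E, CC⟩` with `E = ⟨⟨Y, w₀⟩, st₀⟩`, fold `gateStepF` over the codes of
`CC` from `st₀`. [folklore] -/
def gatePassF : List Bool → List Bool := foldFn gateStepF (sndF ∘ fstF)

/-- `gpParamsF ∈ FP`. [folklore] -/
theorem gpParamsF_mem_FP : gpParamsF ∈ FP := by
  have hE : gpEF ∈ FP := comp_mem_FP fstF_mem_FP (nthF_mem_FP 0)
  have hW : gpW0F ∈ FP := comp_mem_FP sndF_mem_FP (comp_mem_FP fstF_mem_FP hE)
  exact fanoutFn_mem_FP (fanoutFn_mem_FP opF_mem_FP (fanoutFn_mem_FP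
    (comp_mem_FP binToUnaryFn_mem_FP (fanoutFn_mem_FP hW iF_mem_FP))
    (comp_mem_FP binToUnaryFn_mem_FP (fanoutFn_mem_FP hW jF_mem_FP))))
    (comp_mem_FP fstF_mem_FP (comp_mem_FP fstF_mem_FP hE))

/-- `gateStepF ∈ FP`. [folklore] -/
theorem gateStepF_mem_FP : gateStepF ∈ FP :=
  clipF_mem_FP 1 (comp_mem_FP applyMapF_mem_FP (fanoutFn_mem_FP gpParamsF_mem_FP (sndPow_mem_FP 1)))

/-- **`gatePassF ∈ FP`** (clipped step). [cite: AroraBarak2009, §1.3] -/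
theorem gatePassF_mem_FP : gatePassF ∈ FP :=
  foldFn_mem_FP gateStepF_mem_FP (comp_mem_FP sndF_mem_FP fstF_mem_FP) (foldGrowth_clipF 1 _)

section Spec

variable (Y : List Bool) (base : QReg N) (st₀ cc : List Bool)

/-- The input of the gate pass. [folklore] -/
def gpInput : List Bool := boolPair (boolPair (boolPair Y (List.ofFn base)) st₀) cc

/-- **The parameters parsed off a gate code are `gateParams`** (oracle-free gate). [folklore] -/
theorem gpParamsF_encode (g : QGate cliffordT N) (hg : g.IsOracleFree) (acc : List Bool) :
    gpParamsF (boolPair (gpInput Y base st₀ cc) (boolPair g.encode acc)) = gateParams g Y := by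
  have hW : ∀ a : List Bool, gpW0F (boolPair (gpInput Y base st₀ cc) (boolPair a acc)) = List.ofFn base := fun a => by
    simp [gpW0F, gpEF, gpInput, Brick.nthF_zero]
  have hY : ∀ a : List Bool, gpYF (boolPair (gpInput Y base st₀ cc) (boolPair a acc)) = Y := fun a => by
    simp [gpYF, gpEF, gpInput, Brick.nthF_zero]
  have key : ∀ (op ar rest : List Bool) (i : Fin N),
      opF (boolPair (gpInput Y base st₀ cc) (boolPair (false :: boolPair op (boolPair ar (boolPair (encodeNat (i : ℕ)) rest))) acc)) = op ∧
      gpUiF (boolPair (gpInput Y base st₀ cc) (boolPair (false :: boolPair op (boolPair ar (boolPair (encodeNat (i : ℕ)) rest))) acc)) = ones i ∧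
      gpUjF (boolPair (gpInput Y base st₀ cc) (boolPair (false :: boolPair op (boolPair ar (boolPair (encodeNat (i : ℕ)) rest))) acc)) =
        binToUnaryFn (boolPair (List.ofFn base) (fstF rest)) := by
    intro op ar rest i
    obtain ⟨hop, hi, hj, -, -, -⟩ := pieces (gpInput Y base st₀ cc) op ar (encodeNat (i : ℕ)) rest acc
    refine ⟨hop, ?_, ?_⟩
    · rw [gpUiF, Function.comp_apply, pr_apply, hW, hi]; exact ADH.binToUnaryFn_label base i
    · rw [gpUjF, Function.comp_apply, pr_apply, hW, hj]
  have hnil : binToUnaryFn (boolPair (List.ofFn base) (fstF [])) = [] := by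
    rw [show fstF ([] : List Bool) = [] from rfl, binToUnaryFn_boolPair]; simp [ones]
  cases g with
  | oracle k e => exact absurd hg id
  | gate op e =>
    cases op with
    | H =>
      obtain ⟨h1, h2, h3⟩ := key [] [true] [] (embH e 0)
      rw [ADH.encode_gateH, gpParamsF, pr_apply, pr_apply, pr_apply, h1, h2, h3, hnil, hY]; rfl
    | S =>
      obtain ⟨h1, h2, h3⟩ := key [true] [true] [] (embS e 0)
      rw [ADH.encode_gateS, gpParamsF, pr_apply, pr_apply, pr_apply, h1, h2, h3, hnil, hY]; rfl
    | T =>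
      obtain ⟨h1, h2, h3⟩ := key [false, true] [true] [] (embT e 0)
      rw [ADH.encode_gateT, gpParamsF, pr_apply, pr_apply, pr_apply, h1, h2, h3, hnil, hY]; rfl
    | CNOT =>
      obtain ⟨h1, h2, h3⟩ := key [true, true] [true, true] (boolPair (encodeNat (embC e 1 : ℕ)) []) (embC e 0)
      rw [ADH.encode_gateCNOT, gpParamsF, pr_apply, pr_apply, pr_apply, h1, h2, h3, fstF_boolPair, hY,
        ADH.binToUnaryFn_label base (embC e 1)]
      rfl

/-- **The unclipped gate step applies the gate** when the new codes fit in `|Y|`. [folklore] -/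
theorem gateStep_plain (g : QGate cliffordT N) (hg : g.IsOracleFree) (st : List (QReg N × Amp))
    (hfit : ∀ p ∈ st, (ampEnc (newAmp st g p)).length ≤ Y.length) :
    (applyMapF ∘ pr gpParamsF (sndPow 1)) (boolPair (gpInput Y base st₀ cc) (boolPair g.encode (stEnc st))) =
      stEnc (applyGate g st) := by
  have hacc : sndPow 1 (boolPair (gpInput Y base st₀ cc) (boolPair g.encode (stEnc st))) = stEnc st := by simp [sndPow]
  rw [Function.comp_apply, pr_apply, gpParamsF_encode Y base st₀ cc g hg, hacc]
  exact applyMapF_stEnc g hg Y st hfit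

/-- **The unclipped gate pass runs the gates** from a state with small codes, as long as the
yardstick leaves room: `14 (t + |gs| + 1) + 20 ≤ |Y|`. [folklore] -/
theorem gatePass_plain : ∀ (gs : List (QGate cliffordT N)) {t : ℕ} (st : List (QReg N × Amp)),
    (∀ g ∈ gs, g.IsOracleFree) → (∀ p ∈ st, AmpLt t p.2) → 14 * (t + gs.length + 1) + 20 ≤ Y.length →
    (gs.map QGate.encode).foldl (fun acc a => (applyMapF ∘ pr gpParamsF (sndPow 1))
      (boolPair (gpInput Y base st₀ cc) (boolPair a acc))) (stEnc st) = stEnc (runGates gs st)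
  | [], t, st, _, _, _ => rfl
  | g :: gs, t, st, hfree, hst, hY => by
    rw [List.map_cons, List.foldl_cons, runGates_cons,
      gateStep_plain Y base st₀ cc g (hfree g List.mem_cons_self) st (fun p hp => ?_)]
    · exact gatePass_plain gs (applyGate g st) (fun g' hg' => hfree g' (List.mem_cons_of_mem g hg'))
        (ampLt_applyGate hst g) (by simp only [List.length_cons] at hY; omega)
    · refine ((ampLt_newAmp hst g hp).length_ampEnc_le).trans ?_
      simp only [List.length_cons] at hY; omega

end Spec

/-- **The gate pass computes `runGates`** on the codes of an oracle-free kept-gate list from the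
initial state of the cone, provided the yardstick dominates the code sizes and the input the state
sizes. [folklore] -/
theorem gatePassF_spec (Y : List Bool) (S : List (Fin N)) (base : QReg N) (cc : List (QGate cliffordT N))
    (hfree : ∀ g ∈ cc, g.IsOracleFree) (hY : 14 * cc.length + 48 ≤ Y.length)
    (hsize : 2 ^ S.length * (4 * N + 28 * cc.length + 74) ≤ (gpInput Y base (stEnc (initState S base)) (ccEnc cc)).length + 1) :
    gatePassF (gpInput Y base (stEnc (initState S base)) (ccEnc cc)) = stEnc (runGates cc (initState S base)) := by
  set w := gpInput Y base (stEnc (initState S base)) (ccEnc cc) with hw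
  have hini : (sndF ∘ fstF) w = stEnc (initState S base) := by simp [hw, gpInput]
  have hsnd : sndF w = ccEnc cc := by rw [hw, gpInput, sndF_boolPair]
  rw [gatePassF, foldFn_apply, hini, hsnd, ccEnc, decNil_encList, gateStepF]
  rw [foldl_clip_eq w _ _ (fun k hk => ?_)]
  · exact gatePass_plain Y base _ _ cc (initState S base) hfree (ampLt_initState S base) (by omega)
  · rw [← List.map_take, gatePass_plain Y base _ _ (cc.take k) (initState S base)
      (fun g hg => hfree g (List.mem_of_mem_take hg)) (ampLt_initState S base)
      (by have : (cc.take k).length ≤ cc.length := List.length_take_le' _ _; omega)]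
    refine (length_stEnc_runGates_le S base (cc.take k)).trans ?_
    have hk' : (cc.take k).length ≤ cc.length := List.length_take_le' _ _
    calc 2 ^ S.length * (4 * N + 28 * (cc.take k).length + 74) ≤ 2 ^ S.length * (4 * N + 28 * cc.length + 74) :=
          Nat.mul_le_mul_left _ (by omega)
      _ ≤ w.length + 1 := hsize
      _ = 1 * (w.length + 1) := (one_mul _).symm


/-! ### Sizes of the read-out sums -/

/-- `|A(a)| < 4 · 4^t` for small `a`. [folklore] -/
theorem natAbs_normA_lt {t : ℕ} {a : Amp} (h : AmpLt t a) : a.normA.natAbs < 4 * 4 ^ t := by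
  obtain ⟨h0, h1, h2, h3⟩ := h
  have e : (4 : ℕ) ^ t = 2 ^ t * 2 ^ t := by rw [← mul_pow]; norm_num
  have s0 : (a.c0 ^ 2).natAbs < 4 ^ t := by rw [Int.natAbs_pow, e, sq]; exact Nat.mul_lt_mul'' h0 h0
  have s1 : (a.c1 ^ 2).natAbs < 4 ^ t := by rw [Int.natAbs_pow, e, sq]; exact Nat.mul_lt_mul'' h1 h1
  have s2 : (a.c2 ^ 2).natAbs < 4 ^ t := by rw [Int.natAbs_pow, e, sq]; exact Nat.mul_lt_mul'' h2 h2
  have s3 : (a.c3 ^ 2).natAbs < 4 ^ t := by rw [Int.natAbs_pow, e, sq]; exact Nat.mul_lt_mul'' h3 h3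
  unfold Amp.normA
  refine lt_of_le_of_lt (Int.natAbs_add_le _ _) ?_
  have := Int.natAbs_add_le (a.c0 ^ 2 + a.c1 ^ 2) (a.c2 ^ 2)
  have := Int.natAbs_add_le (a.c0 ^ 2) (a.c1 ^ 2)
  omega

/-- `|B(a)| < 4 · 4^t` for small `a`. [folklore] -/
theorem natAbs_normB_lt {t : ℕ} {a : Amp} (h : AmpLt t a) : a.normB.natAbs < 4 * 4 ^ t := by
  obtain ⟨h0, h1, h2, h3⟩ := h
  have e : (4 : ℕ) ^ t = 2 ^ t * 2 ^ t := by rw [← mul_pow]; norm_num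
  have s0 : (a.c0 * a.c1).natAbs < 4 ^ t := by rw [Int.natAbs_mul, e]; exact Nat.mul_lt_mul'' h0 h1
  have s1 : (a.c1 * a.c2).natAbs < 4 ^ t := by rw [Int.natAbs_mul, e]; exact Nat.mul_lt_mul'' h1 h2
  have s2 : (a.c2 * a.c3).natAbs < 4 ^ t := by rw [Int.natAbs_mul, e]; exact Nat.mul_lt_mul'' h2 h3
  have s3 : (a.c0 * a.c3).natAbs < 4 ^ t := by rw [Int.natAbs_mul, e]; exact Nat.mul_lt_mul'' h0 h3
  unfold Amp.normB
  refine lt_of_le_of_lt (Int.natAbs_sub_le _ _) ?_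
  have := Int.natAbs_add_le (a.c0 * a.c1 + a.c1 * a.c2) (a.c2 * a.c3)
  have := Int.natAbs_add_le (a.c0 * a.c1) (a.c1 * a.c2)
  omega

/-- The absolute value of a sum of a list is at most the length times a termwise bound. [folklore] -/
theorem natAbs_sum_map_le {α : Type*} (l : List α) (f : α → ℤ) (K : ℕ) (h : ∀ a ∈ l, (f a).natAbs ≤ K) :
    ((l.map f).sum).natAbs ≤ l.length * K := by
  induction l with
  | nil => simp
  | cons a l ih =>
    rw [List.map_cons, List.sum_cons, List.length_cons]
    have h1 := h a List.mem_cons_self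
    have h2 := ih fun b hb => h b (List.mem_cons_of_mem a hb)
    have := Int.natAbs_add_le (f a) (l.map f).sum
    nlinarith

/-- **The read-out sums of a state with small codes are small**: `|A|, |B| ≤ #st · 4 · 4^t`.
[folklore] -/
theorem natAbs_sums_le {t : ℕ} {st : List (QReg N × Amp)} (hst : ∀ p ∈ st, AmpLt t p.2) :
    (sums st).1.natAbs ≤ st.length * (4 * 4 ^ t) ∧ (sums st).2.natAbs ≤ st.length * (4 * 4 ^ t) := by
  rw [sums_eq]
  constructor
  · refine natAbs_sum_map_le st _ _ fun p hp => ?_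
    split_ifs
    · exact (natAbs_normA_lt (hst p hp)).le
    · simp
  · refine natAbs_sum_map_le st _ _ fun p hp => ?_
    split_ifs
    · exact (natAbs_normB_lt (hst p hp)).le
    · simp

/-! ### The read-out pass -/

/-- The entry's label. [folklore] -/
def suYF : List Bool → List Bool := fstF ∘ nthF 1
/-- The entry's coordinate code. [folklore] -/
def suAF : List Bool → List Bool := sndF ∘ nthF 1
/-- The running `A`. [folklore] -/
def suRAF : List Bool → List Bool := fstF ∘ sndPow 1
/-- The running `B`. [folklore] -/
def suRBF : List Bool → List Bool := sndF ∘ sndPow 1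
/-- "wire `0` of the label reads `1`" (its first bit). [folklore] -/
def suW0T : List Bool → List Bool := ADH.bitT suYF

/-- **One step of the read-out** (clipped): add `⟨A(a), B(a)⟩` to the running sums if wire `0` of the
label reads `1`. [folklore] -/
def sumStepF : List Bool → List Bool :=
  clipF 1 (iteFn suW0T (pr (zaddF ∘ pr suRAF (normAF ∘ suAF)) (zaddF ∘ pr suRBF (normBF ∘ suAF))) (sndPow 1))

/-- **The read-out pass**: on `⟨Y, st⟩`, fold `sumStepF` over the entries of `st` from `⟨dpEnc 0, dpEnc 0⟩`.
[folklore] -/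
def sumPassF : List Bool → List Bool := foldFn sumStepF (fun _ => boolPair (dpEnc 0) (dpEnc 0))

/-- `sumStepF ∈ FP`. [folklore] -/
theorem sumStepF_mem_FP : sumStepF ∈ FP := by
  have hy : suYF ∈ FP := comp_mem_FP fstF_mem_FP (nthF_mem_FP 1)
  have ha : suAF ∈ FP := comp_mem_FP sndF_mem_FP (nthF_mem_FP 1)
  exact clipF_mem_FP 1 (iteFn_mem_FP (ADH.bitT_mem_FP hy)
    (fanoutFn_mem_FP (comp_mem_FP zaddF_mem_FP (fanoutFn_mem_FP (comp_mem_FP fstF_mem_FP (sndPow_mem_FP 1)) (comp_mem_FP normAF_mem_FP ha)))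
      (comp_mem_FP zaddF_mem_FP (fanoutFn_mem_FP (comp_mem_FP sndF_mem_FP (sndPow_mem_FP 1)) (comp_mem_FP normBF_mem_FP ha))))
    (sndPow_mem_FP 1))

/-- **`sumPassF ∈ FP`** (clipped step). [cite: AroraBarak2009, §1.3] -/
theorem sumPassF_mem_FP : sumPassF ∈ FP := foldFn_mem_FP sumStepF_mem_FP (const_mem_FP _) (foldGrowth_clipF 1 _)

/-- The first bit of a label is wire `0`. [folklore] -/
theorem headBit_ofFn (y : QReg N) : ADH.headBit (List.ofFn y) = wire0 y := by
  unfold wire0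
  cases N with
  | zero => simp
  | succ n => rw [List.ofFn_succ, ADH.headBit_cons, dif_pos (Nat.succ_pos n)]; rfl

/-- **The unclipped read-out step on an entry code.** [folklore] -/
theorem sumStep_plain (w : List Bool) (p : QReg N × Amp) (A B : ℤ) :
    iteFn suW0T (pr (zaddF ∘ pr suRAF (normAF ∘ suAF)) (zaddF ∘ pr suRBF (normBF ∘ suAF))) (sndPow 1)
      (boolPair w (boolPair (itemEnc p) (boolPair (dpEnc A) (dpEnc B)))) =
      boolPair (dpEnc (if wire0 p.1 = true then A + p.2.normA else A)) (dpEnc (if wire0 p.1 = true then B + p.2.normB else B)) := by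
  have hy : suYF (boolPair w (boolPair (itemEnc p) (boolPair (dpEnc A) (dpEnc B)))) = List.ofFn p.1 := by simp [suYF, nthF, itemEnc]
  have ha : suAF (boolPair w (boolPair (itemEnc p) (boolPair (dpEnc A) (dpEnc B)))) = ampEnc p.2 := by simp [suAF, nthF, itemEnc]
  have hA : suRAF (boolPair w (boolPair (itemEnc p) (boolPair (dpEnc A) (dpEnc B)))) = dpEnc A := by simp [suRAF, sndPow]
  have hB : suRBF (boolPair w (boolPair (itemEnc p) (boolPair (dpEnc A) (dpEnc B)))) = dpEnc B := by simp [suRBF, sndPow]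
  have hacc : sndPow 1 (boolPair w (boolPair (itemEnc p) (boolPair (dpEnc A) (dpEnc B)))) = boolPair (dpEnc A) (dpEnc B) := by
    simp [sndPow]
  have hbit : suW0T (boolPair w (boolPair (itemEnc p) (boolPair (dpEnc A) (dpEnc B)))) = [wire0 p.1] := by
    rw [suW0T, ADH.bitT_apply, hy, headBit_ofFn]
  rw [iteFn_apply hbit]
  cases wire0 p.1
  · simp only [Bool.false_eq_true, if_false, hacc]
  · simp only [if_true, pr_apply, Function.comp_apply, hA, hB, ha, normAF_ampEnc, normBF_ampEnc, zaddF_boolPair, ival_dpEnc]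

/-- The unclipped read-out over a list of entries. [folklore] -/
theorem sumPass_plain (w : List Bool) : ∀ (items : List (QReg N × Amp)) (A B : ℤ),
    (items.map itemEnc).foldl (fun acc a => iteFn suW0T (pr (zaddF ∘ pr suRAF (normAF ∘ suAF)) (zaddF ∘ pr suRBF (normBF ∘ suAF)))
      (sndPow 1) (boolPair w (boolPair a acc))) (boolPair (dpEnc A) (dpEnc B)) =
      boolPair (dpEnc (items.foldl (fun AB p => if wire0 p.1 = true then (AB.1 + p.2.normA, AB.2 + p.2.normB) else AB) (A, B)).1)
        (dpEnc (items.foldl (fun AB p => if wire0 p.1 = true then (AB.1 + p.2.normA, AB.2 + p.2.normB) else AB) (A, B)).2)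
  | [], A, B => rfl
  | p :: items, A, B => by
    rw [List.map_cons, List.foldl_cons, List.foldl_cons, sumStep_plain]
    by_cases h : wire0 p.1 = true
    · simp only [h, if_true]; exact sumPass_plain w items _ _
    · simp only [h, if_false, Bool.false_eq_true]; exact sumPass_plain w items A B

/-- **The read-out pass computes `sums`**: on `⟨Y, stEnc st⟩` with small codes (`AmpLt t`) and
`#st ≤ 2^s`, it returns `⟨dpEnc A, dpEnc B⟩` as soon as `6s + 12t + 26 ≤ |input| + 1`. [folklore] -/
theorem sumPassF_spec (Y : List Bool) (st : List (QReg N × Amp)) {t s : ℕ} (hst : ∀ p ∈ st, AmpLt t p.2)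
    (hlen : st.length ≤ 2 ^ s) (hsize : 6 * s + 12 * t + 26 ≤ (boolPair Y (stEnc st)).length + 1) :
    sumPassF (boolPair Y (stEnc st)) = boolPair (dpEnc (sums st).1) (dpEnc (sums st).2) := by
  set w := boolPair Y (stEnc st) with hw
  rw [sumPassF, foldFn_apply, hw, sndF_boolPair, decNil_stEnc, ← hw, sumStepF]
  rw [foldl_clip_eq w _ _ (fun k hk => ?_), sumPass_plain w st 0 0]
  · rfl
  · rw [← List.map_take, sumPass_plain w (st.take k) 0 0, length_boolPair]
    have hpre : ∀ p ∈ st.take k, AmpLt t p.2 := fun p hp => hst p (List.mem_of_mem_take hp)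
    have hsum := natAbs_sums_le hpre
    rw [sums] at hsum
    have hk : (st.take k).length ≤ 2 ^ s := (List.length_take_le' _ _).trans hlen
    have hpow : (st.take k).length * (4 * 4 ^ t) < 2 ^ (s + 2 * t + 3) := by
      have e : (4 : ℕ) ^ t = 2 ^ (2 * t) := by rw [pow_mul]; norm_num
      calc (st.take k).length * (4 * 4 ^ t) ≤ 2 ^ s * (4 * 4 ^ t) := Nat.mul_le_mul_right _ hk
        _ = 2 ^ (s + 2 * t + 2) := by rw [e, pow_add, pow_add]; ring
        _ < 2 ^ (s + 2 * t + 3) := Nat.pow_lt_pow_right (by norm_num) (by omega)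
    have h1 := ZWCode.length_dpEnc_le_of_lt (lt_of_le_of_lt hsum.1 hpow)
    have h2 := ZWCode.length_dpEnc_le_of_lt (lt_of_le_of_lt hsum.2 hpow)
    omega

/-! ### The verdict -/

/-- `A` from `⟨⟨A, B⟩, 1ʰ⟩`. [folklore] -/
def vAF : List Bool → List Bool := fstF ∘ fstF
/-- `B`. [folklore] -/
def vBF : List Bool → List Bool := sndF ∘ fstF
/-- `1ʰ`. [folklore] -/
def vHF : List Bool → List Bool := sndF
/-- The code `⟨0ʰ1, ε⟩` of `2ʰ`. [folklore] -/
def vMF : List Bool → List Bool := pr (OracleCompose.concatFn ∘ pr (Kannan.zerosFn ∘ vHF) (fun _ => [true])) (fun _ => [])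
/-- Doubling a code. [folklore] -/
def dbl (f : List Bool → List Bool) : List Bool → List Bool := zaddF ∘ pr f f
/-- `10 A = 8A + 2A`. [folklore] -/
def v10AF : List Bool → List Bool := zaddF ∘ pr (dbl (dbl (dbl vAF))) (dbl vAF)
/-- `14 B = 8B + 4B + 2B`. [folklore] -/
def v14BF : List Bool → List Bool := zaddF ∘ pr (zaddF ∘ pr (dbl (dbl (dbl vBF))) (dbl (dbl vBF))) (dbl vBF)
/-- `5 M = 4M + M`. [folklore] -/
def v5MF : List Bool → List Bool := zaddF ∘ pr (dbl (dbl vMF)) vMF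
/-- **`W = 10A + 14B − 5·2ʰ`**. [folklore] -/
def vWF : List Bool → List Bool := zsubF ∘ pr (zaddF ∘ pr v10AF v14BF) v5MF

/-- **The verdict**: `[0 < W]`. [folklore] -/
def verdictF : List Bool → List Bool := iposFn ∘ vWF

/-- `dbl f ∈ FP`. [folklore] -/
theorem dbl_mem_FP {f : List Bool → List Bool} (hf : f ∈ FP) : dbl f ∈ FP := comp_mem_FP zaddF_mem_FP (fanoutFn_mem_FP hf hf)

/-- `vMF ∈ FP`. [folklore] -/
theorem vMF_mem_FP : vMF ∈ FP :=
  fanoutFn_mem_FP (comp_mem_FP OracleCompose.concatFn_mem_FP (fanoutFn_mem_FP (comp_mem_FP Kannan.zerosFn_mem_FP sndF_mem_FP)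
    (const_mem_FP _))) (const_mem_FP _)

/-- **`verdictF ∈ FP`.** [folklore] -/
theorem verdictF_mem_FP : verdictF ∈ FP := by
  have hA : vAF ∈ FP := comp_mem_FP fstF_mem_FP fstF_mem_FP
  have hB : vBF ∈ FP := comp_mem_FP sndF_mem_FP fstF_mem_FP
  have h10 : v10AF ∈ FP := comp_mem_FP zaddF_mem_FP (fanoutFn_mem_FP (dbl_mem_FP (dbl_mem_FP (dbl_mem_FP hA))) (dbl_mem_FP hA))
  have h14 : v14BF ∈ FP := comp_mem_FP zaddF_mem_FP (fanoutFn_mem_FP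
    (comp_mem_FP zaddF_mem_FP (fanoutFn_mem_FP (dbl_mem_FP (dbl_mem_FP (dbl_mem_FP hB))) (dbl_mem_FP (dbl_mem_FP hB)))) (dbl_mem_FP hB))
  have h5 : v5MF ∈ FP := comp_mem_FP zaddF_mem_FP (fanoutFn_mem_FP (dbl_mem_FP (dbl_mem_FP vMF_mem_FP)) vMF_mem_FP)
  exact comp_mem_FP iposFn_mem_FP (comp_mem_FP zsubF_mem_FP (fanoutFn_mem_FP (comp_mem_FP zaddF_mem_FP (fanoutFn_mem_FP h10 h14)) h5))

/-- Value of a doubling. [folklore] -/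
theorem ival_dbl (f : List Bool → List Bool) (z : List Bool) : ival (dbl f z) = 2 * ival (f z) := by
  simp only [dbl, Function.comp_apply, pr_apply, zaddF_boolPair, ival_dpEnc]; ring

/-- **The verdict is the integer test**: on `⟨⟨a, b⟩, 1ʰ⟩`, `[0 < 10 ival a + 14 ival b − 5·2ʰ]`.
[folklore] -/
theorem verdictF_apply (a b : List Bool) (h : ℕ) :
    verdictF (boolPair (boolPair a b) (ones h)) = [decide (0 < 10 * ival a + 14 * ival b - 5 * 2 ^ h)] := by
  set z := boolPair (boolPair a b) (ones h) with hz
  have hM : ival (vMF z) = 2 ^ h := by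
    have h1 : vMF z = boolPair (List.replicate h false ++ [true]) [] := by
      simp [hz, vMF, vHF, ones]
    rw [h1, ival_boolPair, TM2Pass.bitsToNat_zeros_append, bitsToNat_nil]
    simp
  have hA : ival (vAF z) = ival a := by simp [hz, vAF]
  have hB : ival (vBF z) = ival b := by simp [hz, vBF]
  have hadd : ∀ f g : List Bool → List Bool, ival ((zaddF ∘ pr f g) z) = ival (f z) + ival (g z) := fun f g => by
    rw [Function.comp_apply, pr_apply, zaddF_boolPair, ival_dpEnc]
  have h10 : ival (v10AF z) = 10 * ival a := by
    rw [v10AF, hadd]; simp only [ival_dbl, hA]; ring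
  have h14 : ival (v14BF z) = 14 * ival b := by
    rw [v14BF, hadd, hadd]; simp only [ival_dbl, hB]; ring
  have h5 : ival (v5MF z) = 5 * 2 ^ h := by
    rw [v5MF, hadd]; simp only [ival_dbl, hM]; ring
  have hW : ival (vWF z) = 10 * ival a + 14 * ival b - 5 * 2 ^ h := by
    rw [vWF, Function.comp_apply, pr_apply, zsubF_boolPair, ival_dpEnc, hadd, h10, h14, h5]
  rw [verdictF, Function.comp_apply, iposFn_apply, hW]

end LightCone

end Literature.Computability.QuantumComplexity

end
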